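/-
Origin: expansion seat `prover-pub-hodgecm-own-htheta-g2-0`, handover #H24 2026-08-21T13:47:42Z md5 f1ffbfd24d9e (131 l.; NEW additive MODEL leaf — `_ge` twin(s) D12 D13: hyp12_of_census_R1At_ge, hyp34_of_census_R1At_ge; imports HypCensus.KappaJoin + #H23; author item6-p2 (prover-pub-hodgecm2-item6-p2-0) under own-htheta; nothing cited, NOT an E term; sha256 4ba2b89422a7badabcd98799b2a3eecba54dd818d27d667d5d48788f94d82b5b; CERT rc 0 + trio as in the header; NAMES for audit: HodgeCM.Model.HypCensus.hyp12_of_census_R1At_ge HodgeCM.Model.HypCensus.hyp34_of_census_R1At_ge ) (`HOME/pub-hodgecm-own-htheta/stage80/HodgeCM/Model/HypCensus/KappaJoinGe.lean`, md5 f1ffbfd24d9e, 131 lines);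
landed by the p-seat packager p gen 32 (p-g32) in gate run 79 as `HodgeCM/Model/HypCensus/KappaJoinGe.lean` (verbatim).
-/
/-
Copyright (c) 2026 the pub-hodgecm formalisation cell (harness21).  New file, not vendored.
Origin: seat `prover-pub-hodgecm2-item6-p2-0` (unit pub-hodgecm2-item6-p2, TRANSPOSITION item (vi) extra prover p2 queued behind the own-htheta
lineage; coordinator ruling 2026-08-21T13:01:49Z), 2026-08-21 — assignment own-htheta g2 pub-hodgecm STATUS l.15865 13:09:09Z «item6-p2 = batch 2
of the (vi-2) D-HEAD `_ge` TWINS» (hodge-director/ITEM6-SPLIT.md (vi-2)/(vi-4); x2 `D-HEADS-THREADING.md` 8761fc1d3358; x2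
`E-HEADS-FACE-BLUEPRINT.md` 456cabd0ac10 §1 rows `hyp12`/`hyp34`).  Target in PKG: `HodgeCM/Model/HypCensus/KappaJoinGe.lean` (NEW additive leaf beside
`HodgeCM/Model/HypCensus/KappaJoin.lean`, installed md5 af8895f37908; imports `KappaJoin.lean` + `HypOfCensusTypeGe`; nothing of record imports it).  KERNEL ONLY: theorems,
no proof holes, nothing cited, no hypothesis kind of E, no `def`; nothing here is a claim of the manuscripts under adjudication; HC_CM is NOT proved.

WHAT IT IS — the `_ge` twins of D12 `hyp12_of_census_R1At` (:243) and D13 `hyp34_of_census_R1At` (:274) (§3 of the original; §1/§2 carry no guard and are not twinned):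
statements VERBATIM with the sextic guard `(hK : Module.finrank ℚ c.K = 6)` replaced by `(hK : 6 ≤ Module.finrank ℚ c.K)` (what a rank-four face of a
Galois CM field `F` of degree ≥ 6 supplies at `c.K := F`), proofs = the originals' with the ONE call `hyp12_of_census_of_hκAt` / `hyp34_of_census_of_hκAt` replaced by the batch-2 twins `…_ge` of `HypOfCensusTypeGe.lean`.
E's sextic heads are the instances `hK := h6.ge` (`Model.six_le_of_finrank_eq_six`, `ThetaSpaceInputPinGe.lean`:76).  The `Fin 6` in
`jD : InfinitePlace L → EqVar → Fin 6` / `FinSB L⁺ (Fin 6)` is `EqVar := Fin 3 × Fin 2` = the 3 × 2 real coordinates of `V₃ ⊗ W` (rank-keyed), not a degree.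
Generated from the installed original by `work/gen_twins.py` (token edits listed in `work/gen_twins.report`); section variables byte-identical.
-/
import Summits.HodgeConjecture.HodgeCM.Model.HypCensus.KappaJoin
import Summits.HodgeConjecture.HodgeCM.Model.HypCensus.HypOfCensusTypeGe

/-! PORT of `HodgeCM/Model/HypCensus/KappaJoinGe.lean` (HodgeCMPerL run 82) — verbatim mechanical port; provenance in the PORT header line. -/

set_option autoImplicit false

noncomputable section

open scoped TensorProduct InnerProductSpace Matrix Topology Classical
open Filter
open NumberField NumberField.InfinitePlace

namespace HodgeCM.Model.HypCensus

open HodgeCM HodgeCM.Model HodgeCM.Universe HodgeCM.Adelic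
open HodgeCM.Universe (AdelicThetaCore AdelicThetaCore₀ SideData ThetaModel)
open HodgeCM.PerL34 HodgeCM.PerL34.ArchC HodgeCM.PerL34.Fock HodgeCM.PerL34.Fock.PrintDict
open HodgeCM.Model.ArchSideTerm (e₁ posIdxEquivUnit negIdxEquivEmpty lambdaExponent)
open Literature.AlgebraicGeometry.HodgeTheory
open Literature.NumberTheory.Automorphic.PicardCM
open Literature.NumberTheory.Transcendental (Arapura2012_Cor_15_4_6)
open Literature.NumberTheory.Automorphic (piSchwartzBruhat FinSB)
open Literature.NumberTheory.Automorphic.UnitaryGroup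
open Literature.NumberTheory.Weil1964 (repWeilThetaDatum PosIdx NegIdx)
open Literature.NumberTheory.GelbartRogawski1991 Literature.NumberTheory.GelbartRogawski1991.UnitaryDualPair
open Literature.RepresentationTheory.CompactGroups (UnitaryGroupChar.diagU UnitaryGroupChar.coe_diagU)
open NumberField.SeesawArchTorus



section R1

variable (hHD : exists_isReal_hodgeModel) (hI : hodgePQ_independent_of_hodgeModel)
  (h₁ : BallQuotientUniformised)  (h₃ : CMAbelianVarietyRealised)
variable (hA : Arapura2012_Cor_15_4_6)
variable
  (hGR : ∀ {L : CMField} {ι₁ : L →+* ℂ} (V : HermSpace3 L ι₁) (c : SeesawCtx L),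
    (cmSplittingDatum (L : Type) finProdFinEquiv (frameD V) (frameD_real V) (frameD_ne V) (dW c.D) (dW_real c.D) (dW_ne c.D)).CompatibleSplitting)
  (hGR₀ : ∀ {L : CMField} {ι₁ : L →+* ℂ} (V : HermSpace3 L ι₁) (c : SeesawCtx L),
    (cmSplittingDatum (L : Type) (e₁) (frameD V) (frameD_real V) (frameD_ne V) (lineVec (L : Type) (dW c.D 0))
      (fun _ => dW_real c.D 0) (fun _ => dW_ne c.D 0)).CompatibleSplitting)
  (hGR₁ : ∀ {L : CMField} {ι₁ : L →+* ℂ} (V : HermSpace3 L ι₁) (c : SeesawCtx L),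
    (cmSplittingDatum (L : Type) (e₁) (frameD V) (frameD_real V) (frameD_ne V) (lineVec (L : Type) (dW c.D 1))
      (fun _ => dW_real c.D 1) (fun _ => dW_ne c.D 1)).CompatibleSplitting)
  (χW : ∀ {L : CMField} {ι₁ : L →+* ℂ} (_V : HermSpace3 L ι₁) (_c : SeesawCtx L),
    ContinuousMonoidHom (Literature.NumberTheory.Automorphic.relNormOneIdeles (maximalRealSubfield (L : Type)) (L : Type) ⧸
      Literature.NumberTheory.Automorphic.relNormOneRat (maximalRealSubfield (L : Type)) (L : Type)) Circle)
  (S : ∀ {L : CMField} {ι₁ : L →+* ℂ} (V : HermSpace3 L ι₁) (c : SeesawCtx L), ThetaAdelicSide V c)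
  (μ : ∀ {L : CMField}, SeesawCtx L → Fin 4 → InfinitePlace L → ℤ)
variable {L : CMField} {ι₁ : L →+* ℂ} (V : HermSpace3 L ι₁) (c : SeesawCtx L)

/-- `_ge` TWIN of `hyp12_of_census_R1At` (guard `6 ≤ [c.K:ℚ]` in place of `= 6`; statement otherwise verbatim, proof = the original's with the one `_ge` callee). **E's binder `hyp12` (row 18) AT ONE GOOD CANONICAL CONTEXT for the W family at the R1 pin's CONSTRUCTED `χV := SInstance.χVR`, modulo the (J-T) junction `homg` ONLY** ((V-val) discharged by `hasArchType_χVR_pairType`; (J-dense) by #70). -/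
theorem hyp12_of_census_R1At_ge
    (hc : (thetaModelOf hHD hI h₁ h₃ (orientBitι L ι₁) (_root_.HodgeCM.Model.embOf hHD hI h₁ h₃) (coverOf hHD hI h₁ h₃ hA) (wmOfInput (Wcm hGR (EtaChi.η (@SInstance.χVR @hGR @hGR₀ @hGR₁) @χW) (EtaChi.hη (@SInstance.χVR @hGR @hGR₀ @hGR₁) @χW) (EtaChi.hηc (@SInstance.χVR @hGR @hGR₀ @hGR₁) @χW))) (thetaOf _ (thetaClassInputOf _ (fun V c => thetaSpaceInputOf hHD hI h₁ h₃ S V c))) (d12Of μ) (d34Of μ)).GoodCtx ι₁ c)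
    (hK : 6 ≤ Module.finrank ℚ c.K) (hcan : (InfinitePlace.mk ι₁).embedding = ι₁)
    (jD : InfinitePlace (L : Type) → EqVar → Fin 6) {σ : InfinitePlace (L : Type) → Equiv.Perm (Fin 2)}
    (homg : ∀ (hW : (∀ j, 0 < (ι₁ ((dW c.D) j)).re) ∨ ∀ j, (ι₁ ((dW c.D) j)).re < 0) (f : FinSB ↥(maximalRealSubfield L) (Fin 6))
      (t : (printedAtσ V c.D hW jD (fun w => -μ c 0 w) (fun w => -μ c 1 w) σ).Tg)
      (φ : (printedAtσ V c.D hW jD (fun w => -μ c 0 w) (fun w => -μ c 1 w) σ).F),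
      omgW (Wcm hGR (EtaChi.η (@SInstance.χVR @hGR @hGR₀ @hGR₁) @χW) (EtaChi.hη (@SInstance.χVR @hGR @hGR₀ @hGR₁) @χW) (EtaChi.hηc (@SInstance.χVR @hGR @hGR₀ @hGR₁) @χW) V c)
          (printedTorusHom (kindOf (L : Type) (frameD V) (frameD_real V) (dW c.D) (dW_real c.D) ι₁ (datumAtσ V c.D jD (jIOf V c.D hW) σ))
            (lamOf (L : Type) (frameD V) (frameD_real V) (dW c.D) (dW_real c.D) ι₁ (datumAtσ V c.D jD (jIOf V c.D hW) σ))
            (lamOf_ne_zero (L : Type) (frameD V) (frameD_real V) (dW c.D) (dW_real c.D) ι₁ (datumAtσ V c.D jD (jIOf V c.D hW) σ))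
            (c.D.jT₁₂.toMonoidHom.comp (toAdeles (L : Type)))
            (pinnedVacs (kindOf (L : Type) (frameD V) (frameD_real V) (dW c.D) (dW_real c.D) ι₁ (datumAtσ V c.D jD (jIOf V c.D hW) σ))
              (fun w => -μ c 0 w) (fun w => -μ c 1 w)) t)
          (ins (L : Type) (frameD V) (frameD_real V) (frameD_ne V) (dW c.D) (dW_real c.D) (dW_ne c.D) ι₁ (datumAtσ V c.D jD (jIOf V c.D hW) σ)
            (fun w => -μ c 0 w) (fun w => -μ c 1 w) f φ) =
        ins (L : Type) (frameD V) (frameD_real V) (frameD_ne V) (dW c.D) (dW_real c.D) (dW_ne c.D) ι₁ (datumAtσ V c.D jD (jIOf V c.D hW) σ)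
          (fun w => -μ c 0 w) (fun w => -μ c 1 w) f
          ((printedAtσ V c.D hW jD (fun w => -μ c 0 w) (fun w => -μ c 1 w) σ).ωT t φ)) :
    Nonempty (((coreOf _ (_root_.HodgeCM.Model.embOf hHD hI h₁ h₃) (coverOf hHD hI h₁ h₃ hA) (wmOfInput (Wcm hGR (EtaChi.η (@SInstance.χVR @hGR @hGR₀ @hGR₁) @χW) (EtaChi.hη (@SInstance.χVR @hGR @hGR₀ @hGR₁) @χW) (EtaChi.hηc (@SInstance.χVR @hGR @hGR₀ @hGR₁) @χW))) (thetaOf _ (thetaClassInputOf _ (fun V c => thetaSpaceInputOf hHD hI h₁ h₃ S V c)))).toCore (orientBitι L ι₁)).HypSmoothCore12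
      (((coreOf _ (_root_.HodgeCM.Model.embOf hHD hI h₁ h₃) (coverOf hHD hI h₁ h₃ hA) (wmOfInput (Wcm hGR (EtaChi.η (@SInstance.χVR @hGR @hGR₀ @hGR₁) @χW) (EtaChi.hη (@SInstance.χVR @hGR @hGR₀ @hGR₁) @χW) (EtaChi.hηc (@SInstance.χVR @hGR @hGR₀ @hGR₁) @χW))) (thetaOf _ (thetaClassInputOf _ (fun V c => thetaSpaceInputOf hHD hI h₁ h₃ S V c)))).toCore (orientBitι L ι₁)).side12 (d12Of μ)) (((coreOf _ (_root_.HodgeCM.Model.embOf hHD hI h₁ h₃) (coverOf hHD hI h₁ h₃ hA) (wmOfInput (Wcm hGR (EtaChi.η (@SInstance.χVR @hGR @hGR₀ @hGR₁) @χW) (EtaChi.hη (@SInstance.χVR @hGR @hGR₀ @hGR₁) @χW) (EtaChi.hηc (@SInstance.χVR @hGR @hGR₀ @hGR₁) @χW))) (thetaOf _ (thetaClassInputOf _ (fun V c => thetaSpaceInputOf hHD hI h₁ h₃ S V c)))).toCore (orientBitι L ι₁)).side34 (d34Of μ))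
      ((((coreOf _ (_root_.HodgeCM.Model.embOf hHD hI h₁ h₃) (coverOf hHD hI h₁ h₃ hA) (wmOfInput (Wcm hGR (EtaChi.η (@SInstance.χVR @hGR @hGR₀ @hGR₁) @χW) (EtaChi.hη (@SInstance.χVR @hGR @hGR₀ @hGR₁) @χW) (EtaChi.hηc (@SInstance.χVR @hGR @hGR₀ @hGR₁) @χW))) (thetaOf _ (thetaClassInputOf _ (fun V c => thetaSpaceInputOf hHD hI h₁ h₃ S V c)))).toCore (orientBitι L ι₁)).analyticKM (((coreOf _ (_root_.HodgeCM.Model.embOf hHD hI h₁ h₃) (coverOf hHD hI h₁ h₃ hA) (wmOfInput (Wcm hGR (EtaChi.η (@SInstance.χVR @hGR @hGR₀ @hGR₁) @χW) (EtaChi.hη (@SInstance.χVR @hGR @hGR₀ @hGR₁) @χW) (EtaChi.hηc (@SInstance.χVR @hGR @hGR₀ @hGR₁) @χW))) (thetaOf _ (thetaClassInputOf _ (fun V c => thetaSpaceInputOf hHD hI h₁ h₃ S V c)))).toCore (orientBitι L ι₁)).side12 (d12Of μ))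
        (((coreOf _ (_root_.HodgeCM.Model.embOf hHD hI h₁ h₃) (coverOf hHD hI h₁ h₃ hA) (wmOfInput (Wcm hGR (EtaChi.η (@SInstance.χVR @hGR @hGR₀ @hGR₁) @χW) (EtaChi.hη (@SInstance.χVR @hGR @hGR₀ @hGR₁) @χW) (EtaChi.hηc (@SInstance.χVR @hGR @hGR₀ @hGR₁) @χW))) (thetaOf _ (thetaClassInputOf _ (fun V c => thetaSpaceInputOf hHD hI h₁ h₃ S V c)))).toCore (orientBitι L ι₁)).side34 (d34Of μ))).toAnalytic) V c (ℓ := linOfInput (Wcm hGR (EtaChi.η (@SInstance.χVR @hGR @hGR₀ @hGR₁) @χW) (EtaChi.hη (@SInstance.χVR @hGR @hGR₀ @hGR₁) @χW) (EtaChi.hηc (@SInstance.χVR @hGR @hGR₀ @hGR₁) @χW)) V c)) := by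
  have hc' : SignRecipe.GoodCtx (orientBitι L ι₁) ι₁ c :=
    ((cpinC hHD hI h₁ h₃ hA (Wcm hGR (EtaChi.η (@SInstance.χVR @hGR @hGR₀ @hGR₁) @χW) (EtaChi.hη (@SInstance.χVR @hGR @hGR₀ @hGR₁) @χW) (EtaChi.hηc (@SInstance.χVR @hGR @hGR₀ @hGR₁) @χW)) S).thetaModel_goodCtx_iff
      (orientBitι L ι₁) (d12Of μ) (d34Of μ) ι₁ c).mp hc
  exact hyp12_of_census_of_hκAt_ge hHD hI h₁ h₃ (orientBitι L ι₁) hA hGR (EtaChi.η (@SInstance.χVR @hGR @hGR₀ @hGR₁) @χW) (EtaChi.hη (@SInstance.χVR @hGR @hGR₀ @hGR₁) @χW) (EtaChi.hηc (@SInstance.χVR @hGR @hGR₀ @hGR₁) @χW) S μ V c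
    hc hK jD (fun hW => hκ_of_hasArchType_pairType V c.D (hGR V c) hW ((@SInstance.χVR @hGR @hGR₀ @hGR₁) V c) (χW V c) (hposW_of_goodCtx_orientBitι V hc' hcan) hcan
      (hasArchType_χVR_pairType @hGR @hGR₀ @hGR₁ V c ⟨hcan, hc'⟩ hW (hposW_of_goodCtx_orientBitι V hc' hcan))) homg

/-- `_ge` TWIN of `hyp34_of_census_R1At` (guard `6 ≤ [c.K:ℚ]` in place of `= 6`; statement otherwise verbatim, proof = the original's with the one `_ge` callee). **E's binder `hyp34` (row 19) AT ONE GOOD CANONICAL CONTEXT for the W family at the R1 pin's CONSTRUCTED `χV := SInstance.χVR`, modulo the (J-T) junction `homg₃₄` ONLY** ((V-val) discharged by `hasArchType_χVR_pairType`; (J-dense) by #70). -/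
theorem hyp34_of_census_R1At_ge
    (hc : (thetaModelOf hHD hI h₁ h₃ (orientBitι L ι₁) (_root_.HodgeCM.Model.embOf hHD hI h₁ h₃) (coverOf hHD hI h₁ h₃ hA) (wmOfInput (Wcm hGR (EtaChi.η (@SInstance.χVR @hGR @hGR₀ @hGR₁) @χW) (EtaChi.hη (@SInstance.χVR @hGR @hGR₀ @hGR₁) @χW) (EtaChi.hηc (@SInstance.χVR @hGR @hGR₀ @hGR₁) @χW))) (thetaOf _ (thetaClassInputOf _ (fun V c => thetaSpaceInputOf hHD hI h₁ h₃ S V c))) (d12Of μ) (d34Of μ)).GoodCtx ι₁ c)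
    (hK : 6 ≤ Module.finrank ℚ c.K) (hcan : (InfinitePlace.mk ι₁).embedding = ι₁)
    (jD : InfinitePlace (L : Type) → EqVar → Fin 6) {σ : InfinitePlace (L : Type) → Equiv.Perm (Fin 2)}
    (homg₃₄ : ∀ (hW : (∀ j, 0 < (ι₁ ((dW c.D) j)).re) ∨ ∀ j, (ι₁ ((dW c.D) j)).re < 0) (f : FinSB ↥(maximalRealSubfield L) (Fin 6))
      (t : (printedAtσ V c.D hW jD (fun w => -μ c 2 w) (fun w => -μ c 3 w) σ).Tg)
      (φ : (printedAtσ V c.D hW jD (fun w => -μ c 2 w) (fun w => -μ c 3 w) σ).F),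
      omgW (Wcm hGR (EtaChi.η (@SInstance.χVR @hGR @hGR₀ @hGR₁) @χW) (EtaChi.hη (@SInstance.χVR @hGR @hGR₀ @hGR₁) @χW) (EtaChi.hηc (@SInstance.χVR @hGR @hGR₀ @hGR₁) @χW) V c)
          (printedTorusHom (kindOf (L : Type) (frameD V) (frameD_real V) (dW c.D) (dW_real c.D) ι₁ (datumAtσ V c.D jD (jIOf V c.D hW) σ))
            (lamOf (L : Type) (frameD V) (frameD_real V) (dW c.D) (dW_real c.D) ι₁ (datumAtσ V c.D jD (jIOf V c.D hW) σ))
            (lamOf_ne_zero (L : Type) (frameD V) (frameD_real V) (dW c.D) (dW_real c.D) ι₁ (datumAtσ V c.D jD (jIOf V c.D hW) σ))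
            (c.D.jT₃₄.toMonoidHom.comp (toAdeles (L : Type)))
            (pinnedVacs (kindOf (L : Type) (frameD V) (frameD_real V) (dW c.D) (dW_real c.D) ι₁ (datumAtσ V c.D jD (jIOf V c.D hW) σ))
              (fun w => -μ c 2 w) (fun w => -μ c 3 w)) t)
          (ins₃₄ V c.D (hGR V c) (EtaChi.η (@SInstance.χVR @hGR @hGR₀ @hGR₁) @χW V c) (datumAtσ V c.D jD (jIOf V c.D hW) σ) (fun w => -μ c 2 w) (fun w => -μ c 3 w) f φ) =
        ins₃₄ V c.D (hGR V c) (EtaChi.η (@SInstance.χVR @hGR @hGR₀ @hGR₁) @χW V c) (datumAtσ V c.D jD (jIOf V c.D hW) σ) (fun w => -μ c 2 w) (fun w => -μ c 3 w) f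
          ((printedAtσ V c.D hW jD (fun w => -μ c 2 w) (fun w => -μ c 3 w) σ).ωT t φ)) :
    Nonempty (((coreOf _ (_root_.HodgeCM.Model.embOf hHD hI h₁ h₃) (coverOf hHD hI h₁ h₃ hA) (wmOfInput (Wcm hGR (EtaChi.η (@SInstance.χVR @hGR @hGR₀ @hGR₁) @χW) (EtaChi.hη (@SInstance.χVR @hGR @hGR₀ @hGR₁) @χW) (EtaChi.hηc (@SInstance.χVR @hGR @hGR₀ @hGR₁) @χW))) (thetaOf _ (thetaClassInputOf _ (fun V c => thetaSpaceInputOf hHD hI h₁ h₃ S V c)))).toCore (orientBitι L ι₁)).HypSmoothCore34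
      (((coreOf _ (_root_.HodgeCM.Model.embOf hHD hI h₁ h₃) (coverOf hHD hI h₁ h₃ hA) (wmOfInput (Wcm hGR (EtaChi.η (@SInstance.χVR @hGR @hGR₀ @hGR₁) @χW) (EtaChi.hη (@SInstance.χVR @hGR @hGR₀ @hGR₁) @χW) (EtaChi.hηc (@SInstance.χVR @hGR @hGR₀ @hGR₁) @χW))) (thetaOf _ (thetaClassInputOf _ (fun V c => thetaSpaceInputOf hHD hI h₁ h₃ S V c)))).toCore (orientBitι L ι₁)).side12 (d12Of μ)) (((coreOf _ (_root_.HodgeCM.Model.embOf hHD hI h₁ h₃) (coverOf hHD hI h₁ h₃ hA) (wmOfInput (Wcm hGR (EtaChi.η (@SInstance.χVR @hGR @hGR₀ @hGR₁) @χW) (EtaChi.hη (@SInstance.χVR @hGR @hGR₀ @hGR₁) @χW) (EtaChi.hηc (@SInstance.χVR @hGR @hGR₀ @hGR₁) @χW))) (thetaOf _ (thetaClassInputOf _ (fun V c => thetaSpaceInputOf hHD hI h₁ h₃ S V c)))).toCore (orientBitι L ι₁)).side34 (d34Of μ))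
      ((((coreOf _ (_root_.HodgeCM.Model.embOf hHD hI h₁ h₃) (coverOf hHD hI h₁ h₃ hA) (wmOfInput (Wcm hGR (EtaChi.η (@SInstance.χVR @hGR @hGR₀ @hGR₁) @χW) (EtaChi.hη (@SInstance.χVR @hGR @hGR₀ @hGR₁) @χW) (EtaChi.hηc (@SInstance.χVR @hGR @hGR₀ @hGR₁) @χW))) (thetaOf _ (thetaClassInputOf _ (fun V c => thetaSpaceInputOf hHD hI h₁ h₃ S V c)))).toCore (orientBitι L ι₁)).analyticKM (((coreOf _ (_root_.HodgeCM.Model.embOf hHD hI h₁ h₃) (coverOf hHD hI h₁ h₃ hA) (wmOfInput (Wcm hGR (EtaChi.η (@SInstance.χVR @hGR @hGR₀ @hGR₁) @χW) (EtaChi.hη (@SInstance.χVR @hGR @hGR₀ @hGR₁) @χW) (EtaChi.hηc (@SInstance.χVR @hGR @hGR₀ @hGR₁) @χW))) (thetaOf _ (thetaClassInputOf _ (fun V c => thetaSpaceInputOf hHD hI h₁ h₃ S V c)))).toCore (orientBitι L ι₁)).side12 (d12Of μ))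
        (((coreOf _ (_root_.HodgeCM.Model.embOf hHD hI h₁ h₃) (coverOf hHD hI h₁ h₃ hA) (wmOfInput (Wcm hGR (EtaChi.η (@SInstance.χVR @hGR @hGR₀ @hGR₁) @χW) (EtaChi.hη (@SInstance.χVR @hGR @hGR₀ @hGR₁) @χW) (EtaChi.hηc (@SInstance.χVR @hGR @hGR₀ @hGR₁) @χW))) (thetaOf _ (thetaClassInputOf _ (fun V c => thetaSpaceInputOf hHD hI h₁ h₃ S V c)))).toCore (orientBitι L ι₁)).side34 (d34Of μ))).toAnalytic) V c (ℓ := linOfInput (Wcm hGR (EtaChi.η (@SInstance.χVR @hGR @hGR₀ @hGR₁) @χW) (EtaChi.hη (@SInstance.χVR @hGR @hGR₀ @hGR₁) @χW) (EtaChi.hηc (@SInstance.χVR @hGR @hGR₀ @hGR₁) @χW)) V c)) := by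
  have hc' : SignRecipe.GoodCtx (orientBitι L ι₁) ι₁ c :=
    ((cpinC hHD hI h₁ h₃ hA (Wcm hGR (EtaChi.η (@SInstance.χVR @hGR @hGR₀ @hGR₁) @χW) (EtaChi.hη (@SInstance.χVR @hGR @hGR₀ @hGR₁) @χW) (EtaChi.hηc (@SInstance.χVR @hGR @hGR₀ @hGR₁) @χW)) S).thetaModel_goodCtx_iff
      (orientBitι L ι₁) (d12Of μ) (d34Of μ) ι₁ c).mp hc
  exact hyp34_of_census_of_hκAt_ge hHD hI h₁ h₃ (orientBitι L ι₁) hA hGR (EtaChi.η (@SInstance.χVR @hGR @hGR₀ @hGR₁) @χW) (EtaChi.hη (@SInstance.χVR @hGR @hGR₀ @hGR₁) @χW) (EtaChi.hηc (@SInstance.χVR @hGR @hGR₀ @hGR₁) @χW) S μ V c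
    hc hK jD (fun hW => hκ_of_hasArchType_pairType V c.D (hGR V c) hW ((@SInstance.χVR @hGR @hGR₀ @hGR₁) V c) (χW V c) (hposW_of_goodCtx_orientBitι V hc' hcan) hcan
      (hasArchType_χVR_pairType @hGR @hGR₀ @hGR₁ V c ⟨hcan, hc'⟩ hW (hposW_of_goodCtx_orientBitι V hc' hcan))) homg₃₄

end R1

end HodgeCM.Model.HypCensus

end
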